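import Literature.Probability.LatticeModels.ScaleFrameKernelBound
import HarnessLib

/-!
# Kesten's Lemma (23) on a scale frame: bounded cross-ratios of the chain kernel (proved)

Topic `Literature/Probability/LatticeModels` (trunk `StatMech`, family `crit-ising`). The central
probabilistic brick of Kesten's ratio-limit theorem for dependent percolation (H. Kesten, *The
incipient infinite cluster in two-dimensional percolation*, PTRF 73 (1986), §2, Lemma (23)) in the
planarity-free form of D. Basu, A. Sapozhnikov (ECP 22 (2017), §2, eq. (2.9)), for the finite-graph
random-cluster measure `rcMeasure`, `q ≥ 1`, on an abstract `ScaleFrame` carrying an RSW ladder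
`LadderRSWb p q c a M (m+16+g) 13`: the chain kernel `N(o, d') = P[Fo ∩ Fd(d') ∩ {R' ↔ R inside
Wo ∖ U'}]` over inner exploration data `d' = (U', R')` of the block `(a, aM^m)` (rim wired OFF the
inside) and outer contexts `o = (Fo, Wo, R)` (an event of the frame edges beyond radius `aM^{m+16+g}`,
a region `Wo ⊇ {good, rad < aM^{m+16+g}}`, a target `R ⊆ Wo` out there) has cross-ratios bounded by
`q⁸ / c²⁰`: `N(o,d') N(õ,d'') ≤ (q⁸/c²⁰) N(o,d'') N(õ,d')` (`ScaleFrame.kernel_crossRatio_le`,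
registered short name `kernel_crossRatio_le`). Proof: every entry is within `[q⁻² c⁶, q² c⁻²]` of a
product `π(d') S(o)` (`ScaleFrame.kernel_entry_bounds`: Markov at the inner datum, partition by the
datum of the gap exploration `(aM^{m+15}, aM^{m+16})` from outside, Markov at the gap datum,
quasi-multiplicativity of the connection across the gap, comparability of the gap datum across
environments, and the junk bound for rims not wired off), and products have cross-ratio one.
Everything is proved; no definitions, no named facts.

## References

* [Kesten1986] H. Kesten, *Probab. Theory Related Fields* 73 (1986) 369–394, §2, Lemma (23).
* [BasuSapozhnikov2017ECP] D. Basu, A. Sapozhnikov, *Electron. Commun. Probab.* 22 (2017) no. 26,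
  §2, eq. (2.9).
-/

noncomputable section

open MeasureTheory Finset SimpleGraph
open Literature.Probability.Percolation (BondConfig openConnIn openCrossing explEvent)

namespace Literature.Probability.LatticeModels

/-- **Kesten's Lemma (23) for the Basu–Sapozhnikov kernel over a scale frame.** Inner data
`(U', R')` explore the block `(a, aM^m)` from `inSet a`; an outer CONTEXT is a triple `(Fo, Wo, R)`: an
event `Fo` determined by the edges inside `Out₀ = outSet (aM^(m+16)) (aM^(m+16+g))`, a vertex set
`Wo ⊇ {good, rad < aM^(m+16+g)}` and an outer target `R ⊆ Wo ∩ Out₀`. The kernel entry is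
`N(o, d') = P[Fo ∩ Fd' ∩ {R' ↔ R inside Wo ∖ U'}]` under the free measure of the frame; its cross-ratios
over two contexts and two inner data are bounded by `q^8 / c^20` (rim wired OFF the inside: Off family).
[cite: Kesten1986, §2 Lemma (23)] -/
theorem ScaleFrame.kernel_crossRatio_le :
    ∀ {V : Type*} [Fintype V] [DecidableEq V] (F : ScaleFrame V) {p q c a M : ℝ} {m g : ℕ},
      p ∈ Set.Ico (0 : ℝ) 1 → 1 ≤ q → 0 < c → c ≤ 1 → 0 < a → 4 ≤ M → 1 ≤ m → 1 ≤ g →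
      a * M ^ (m + 16 + g) ≤ F.Rmax → F.η ≤ a →
      F.LadderRSWb p q c a M (m + 16 + g) 13 →
    ∀ (U' R' U'' R'' : Set V),
      (∀ v ∈ U', v ∈ F.good ∧ F.rad v < a * M ^ m) → (∀ v ∈ R', v ∈ F.good ∧ F.rad v < a * M ^ m + F.η) →
      (∀ v ∈ U'', v ∈ F.good ∧ F.rad v < a * M ^ m) → (∀ v ∈ R'', v ∈ F.good ∧ F.rad v < a * M ^ m + F.η) →
    ∀ (Fo Fo' : Set (BondConfig V)) (Wo Wo' R Rq : Set V),
      (∀ ω₁ ω₂ : BondConfig V, (∀ e ∈ F.E, (∀ x ∈ e, x ∈ F.outSet (a * M ^ (m + 16)) (a * M ^ (m + 16 + g))) →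
        (e ∈ ω₁ ↔ e ∈ ω₂)) → (ω₁ ∈ Fo ↔ ω₂ ∈ Fo)) →
      (∀ ω₁ ω₂ : BondConfig V, (∀ e ∈ F.E, (∀ x ∈ e, x ∈ F.outSet (a * M ^ (m + 16)) (a * M ^ (m + 16 + g))) →
        (e ∈ ω₁ ↔ e ∈ ω₂)) → (ω₁ ∈ Fo' ↔ ω₂ ∈ Fo')) →
      (∀ v : V, v ∈ F.good → F.rad v < a * M ^ (m + 16 + g) → v ∈ Wo) →
      (∀ v : V, v ∈ F.good → F.rad v < a * M ^ (m + 16 + g) → v ∈ Wo') →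
      R ⊆ Wo ∩ F.outSet (a * M ^ (m + 16)) (a * M ^ (m + 16 + g)) →
      Rq ⊆ Wo' ∩ F.outSet (a * M ^ (m + 16)) (a * M ^ (m + 16 + g)) →
      let P := rcMeasure (fromEdgeSet (↑F.E : Set (Sym2 V))) p q ∅
      let Fd : Set V → Set V → Set (BondConfig V) := fun U₀ R₀ => {ω | ω ∩ (↑F.E : Set (Sym2 V)) ∈
        explEvent (F.inSet a) (F.annSet a (a * M ^ m)) U₀ R₀ ∩
          {ω | ∀ r ∈ R₀, ∀ r₂ ∈ R₀, ∃ v ∈ U₀ \ F.inSet a, ∃ v' ∈ U₀ \ F.inSet a,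
            s(v, r) ∈ ω ∧ s(v', r₂) ∈ ω ∧ ω ∈ openConnIn (U₀ \ F.inSet a) v v'}}
      let N : Set (BondConfig V) → Set V → Set V → Set V → Set V → ℝ := fun Fo₀ Wo₀ R₀ U₀ R₀' =>
        P.real (Fo₀ ∩ Fd U₀ R₀' ∩ openCrossing (Wo₀ \ U₀) R₀' R₀)
      N Fo Wo R U' R' * N Fo' Wo' Rq U'' R'' ≤
        q ^ 8 / c ^ 20 * (N Fo Wo R U'' R'' * N Fo' Wo' Rq U' R') := by
  intro V _ _ F p q c a M m g hp hq hc hc1 ha hM hm hg hR hη hL U' R' U'' R'' hU' hR' hU'' hR'' Fo Fo' Wo Wo'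
    R Rq hFo hFo' hWo hWo' hRR hRq P Fd N
  obtain ⟨π, S, hπ, hS, hb⟩ := F.kernel_entry_bounds hp hq hc hc1 ha hM hg hR hη hL N rfl
  obtain ⟨h1, -⟩ := hb U' R' hU' hR' Fo Wo R hFo hWo hRR
  obtain ⟨h2, -⟩ := hb U'' R'' hU'' hR'' Fo' Wo' Rq hFo' hWo' hRq
  obtain ⟨-, h3⟩ := hb U'' R'' hU'' hR'' Fo Wo R hFo hWo hRR
  obtain ⟨-, h4⟩ := hb U' R' hU' hR' Fo' Wo' Rq hFo' hWo' hRq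
  have hN : ∀ Fo₀ Wo₀ R₀ U₀ R₀', 0 ≤ N Fo₀ Wo₀ R₀ U₀ R₀' := fun _ _ _ _ _ => measureReal_nonneg
  have hq0 : 0 < q := one_pos.trans_le hq
  have hc16 : c ^ 20 ≤ c ^ 16 := pow_le_pow_of_le_one hc.le hc1 (by norm_num)
  calc N Fo Wo R U' R' * N Fo' Wo' Rq U'' R''
      ≤ (q ^ 2 / c ^ 2 * (π U' R' * S Fo Wo R)) * (q ^ 2 / c ^ 2 * (π U'' R'' * S Fo' Wo' Rq)) :=
        mul_le_mul h1 h2 (hN _ _ _ _ _) (mul_nonneg (by positivity) (mul_nonneg (hπ _ _) (hS _ _ _)))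
    _ = (q ^ 2 / c ^ 2) ^ 2 * ((π U'' R'' * S Fo Wo R) * (π U' R' * S Fo' Wo' Rq)) := by ring
    _ ≤ (q ^ 2 / c ^ 2) ^ 2 *
          ((q ^ 2 / c ^ 6 * N Fo Wo R U'' R'') * (q ^ 2 / c ^ 6 * N Fo' Wo' Rq U' R')) :=
        mul_le_mul_of_nonneg_left (mul_le_mul h3 h4 (mul_nonneg (hπ _ _) (hS _ _ _))
          (mul_nonneg (by positivity) (hN _ _ _ _ _))) (by positivity)
    _ = q ^ 8 / c ^ 16 * (N Fo Wo R U'' R'' * N Fo' Wo' Rq U' R') := by ring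
    _ ≤ q ^ 8 / c ^ 20 * (N Fo Wo R U'' R'' * N Fo' Wo' Rq U' R') :=
        mul_le_mul_of_nonneg_right (div_le_div_of_nonneg_left (by positivity) (by positivity) hc16)
          (mul_nonneg (hN _ _ _ _ _) (hN _ _ _ _ _))

/-- **(KEY), registered short name** of `ScaleFrame.kernel_crossRatio_le` (statement verbatim).
[cite: Kesten1986, §2 Lemma (23)] -/
theorem kernel_crossRatio_le :
    ∀ {V : Type*} [Fintype V] [DecidableEq V] (F : ScaleFrame V) {p q c a M : ℝ} {m g : ℕ},
      p ∈ Set.Ico (0 : ℝ) 1 → 1 ≤ q → 0 < c → c ≤ 1 → 0 < a → 4 ≤ M → 1 ≤ m → 1 ≤ g →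
      a * M ^ (m + 16 + g) ≤ F.Rmax → F.η ≤ a →
      F.LadderRSWb p q c a M (m + 16 + g) 13 →
    ∀ (U' R' U'' R'' : Set V),
      (∀ v ∈ U', v ∈ F.good ∧ F.rad v < a * M ^ m) → (∀ v ∈ R', v ∈ F.good ∧ F.rad v < a * M ^ m + F.η) →
      (∀ v ∈ U'', v ∈ F.good ∧ F.rad v < a * M ^ m) → (∀ v ∈ R'', v ∈ F.good ∧ F.rad v < a * M ^ m + F.η) →
    ∀ (Fo Fo' : Set (BondConfig V)) (Wo Wo' R Rq : Set V),
      (∀ ω₁ ω₂ : BondConfig V, (∀ e ∈ F.E, (∀ x ∈ e, x ∈ F.outSet (a * M ^ (m + 16)) (a * M ^ (m + 16 + g))) →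
        (e ∈ ω₁ ↔ e ∈ ω₂)) → (ω₁ ∈ Fo ↔ ω₂ ∈ Fo)) →
      (∀ ω₁ ω₂ : BondConfig V, (∀ e ∈ F.E, (∀ x ∈ e, x ∈ F.outSet (a * M ^ (m + 16)) (a * M ^ (m + 16 + g))) →
        (e ∈ ω₁ ↔ e ∈ ω₂)) → (ω₁ ∈ Fo' ↔ ω₂ ∈ Fo')) →
      (∀ v : V, v ∈ F.good → F.rad v < a * M ^ (m + 16 + g) → v ∈ Wo) →
      (∀ v : V, v ∈ F.good → F.rad v < a * M ^ (m + 16 + g) → v ∈ Wo') →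
      R ⊆ Wo ∩ F.outSet (a * M ^ (m + 16)) (a * M ^ (m + 16 + g)) →
      Rq ⊆ Wo' ∩ F.outSet (a * M ^ (m + 16)) (a * M ^ (m + 16 + g)) →
      let P := rcMeasure (fromEdgeSet (↑F.E : Set (Sym2 V))) p q ∅
      let Fd : Set V → Set V → Set (BondConfig V) := fun U₀ R₀ => {ω | ω ∩ (↑F.E : Set (Sym2 V)) ∈
        explEvent (F.inSet a) (F.annSet a (a * M ^ m)) U₀ R₀ ∩
          {ω | ∀ r ∈ R₀, ∀ r₂ ∈ R₀, ∃ v ∈ U₀ \ F.inSet a, ∃ v' ∈ U₀ \ F.inSet a,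
            s(v, r) ∈ ω ∧ s(v', r₂) ∈ ω ∧ ω ∈ openConnIn (U₀ \ F.inSet a) v v'}}
      let N : Set (BondConfig V) → Set V → Set V → Set V → Set V → ℝ := fun Fo₀ Wo₀ R₀ U₀ R₀' =>
        P.real (Fo₀ ∩ Fd U₀ R₀' ∩ openCrossing (Wo₀ \ U₀) R₀' R₀)
      N Fo Wo R U' R' * N Fo' Wo' Rq U'' R'' ≤
        q ^ 8 / c ^ 20 * (N Fo Wo R U'' R'' * N Fo' Wo' Rq U' R') :=
  ScaleFrame.kernel_crossRatio_le

end Literature.Probability.LatticeModels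

end
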